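import Literature.AlgebraicGeometry.Motives.FamiliesVHSComap
import Mathlib.Topology.Homotopy.Lifting
import Mathlib.AlgebraicTopology.FundamentalGroupoid.SimplyConnected
import HarnessLib

/-!
# Determinations of an integral class seen from a covering space: the locus «some determination of `u` is of type `(p,p)`» is the IMAGE of
# the corresponding locus of the pulled-back variation, and on a simply connected cover «some determination» is «the flat section»
# (Cattani–Deligne–Kaplan, Cor. 1.3: «a section of the local system `𝒱_ℤ` on a universal covering of `S`»)

Topic `Literature/AlgebraicGeometry/Motives` (namespace `Literature.AlgebraicGeometry.Motives.VHSData`), lane `lit-hodgefound` (seat `p08`, row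
g55-#7).  THEOREMS ONLY (no definition, no named fact, no instance; D-0026 net debt `0`).  Sequel of `Motives/FamiliesVHSComap.lean` (the pull-back
`f* D = D.comap f`, `determinationLocus_comap_subset`), using Mathlib's path lifting for covering maps (`IsCoveringMap.liftPathQuotient`,
`IsCoveringMap.monodromy`, `IsCoveringMap.map_liftPathQuotient`) and Mathlib's `Subsingleton (Path.Homotopic.Quotient x y)` on a simply connected space.

PRINTED SOURCE, VERBATIM (E. Cattani, P. Deligne, A. Kaplan, *On the locus of Hodge classes*, J. AMS 8 (1995), p. 484; held text
`paper:arxiv-alg-geom_9402009` p0001): «**Corollary 1.3.** Let `u` be a section of the local system `𝒱_ℤ` on a universal covering of `S`. The set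
of points in `S` where some determination of `u` is of type `(0,0)`, is an algebraic subvariety of `S`.  *Proof*: Such set is a union of images of
connected components of `S^{(K)}`, for `K = Q(u,u)`.»; p. 485: «To prove 1.1 one is free to replace `S` of 1.1 by a finite etale covering `S' → S`.»

THE DICTIONARY.  The tree phrases «some determination of `u₀ ∈ V_ℤ,s₀` at `t`» as `∃ γ : Path.Homotopic.Quotient s₀ t, IsHodgeAt t p (γ · u₀)`
(`HodgeTheory/VHSDataDeterminationLocusOverCurve`).  For a covering map `f : S' → S` (Mathlib `IsCoveringMap`) and the pulled-back datum `f* D`: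
* §1 **`image_determinationLocus_comap`** — `f(determination locus of u₀ for f* D from s'₀) = determination locus of u₀ for D from f s'₀`: every
  path class `γ : f s'₀ ⇝ t` lifts to `γ̃ : s'₀ ⇝ t'` with `f ∘ γ̃ = γ` (`liftPathQuotient`), and the transports agree; `mem_determinationLocus_iff_exists_fiber`.
* §2 **`determinationLocus_eq_univ_or_finite_of_comap_covering`** — DESCENT for the determination locus along a SURJECTIVE covering map: everything or
  finite upstairs ⟹ everything or finite downstairs («replace `S` by a finite etale covering»).
* §3 **`determinationLocus_comap_eq_of_simplyConnected`** — on a SIMPLY CONNECTED `S'` (the universal covering) all path classes `s'₀ ⇝ t'` coincide,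
  so the upstairs locus is `{t' | IsHodgeAt t' p (the flat continuation of u₀ to t')}` — «`u` a section of `𝒱_ℤ` on a universal covering … the set
  of points in `S` where some determination of `u` is of type `(0,0)`» is literally `f` of the zero-type locus of that section:
  **`determinationLocus_eq_image_of_simplyConnected`**.

NOT HERE: existence of a universal cover of `S(ℂ)`; finiteness of fibres; holomorphy.

## References

* [CattaniDeligneKaplan1995] E. Cattani, P. Deligne, A. Kaplan, *On the locus of Hodge classes*, J. Amer. Math. Soc. 8 (1995) 483–506: Cor. 1.3
  (p. 484), «Proof of 1.5 ⟹ 1.1» (p. 485).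
* [Deligne1970] P. Deligne, *Équations différentielles à points singuliers réguliers*, LNM 163 (1970), I.1 (local systems and `Π₁`; inverse images).
-/

noncomputable section

open CategoryTheory Set

namespace Literature.AlgebraicGeometry.Motives

namespace VHSData

variable {S : Type} [TopologicalSpace S] {S' : Type} [TopologicalSpace S'] {n : ℤ} (D : VHSData S n) {f : C(S', S)}

/-! ## §1 The determination locus downstairs is the image of the determination locus upstairs -/

/-- **Lifting a determination**: for a covering map `f`, a base point `s'₀ ∈ S'`, an integral `u₀ ∈ V_ℤ,f(s'₀)` and a path class `γ : f s'₀ ⇝ t` with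
`γ · u₀` of type `(p,p)`, the LIFT `γ̃ : s'₀ ⇝ t'` of `γ` (`f t' = t`) has `γ̃ · u₀` of type `(p,p)` for `f* D` — transport of `f* D` along `γ̃` is
transport of `D` along `f ∘ γ̃ = γ`. [cite: CattaniDeligneKaplan1995, Cor. 1.3 (p. 484)] [cite: Deligne1970, I.1] -/
theorem exists_isHodgeAt_comap_of_isHodgeAt (hf : IsCoveringMap f) {p : ℤ} {s'₀ : S'} (u₀ : D.VZ.fiber (f s'₀)) {t : S}
    (γ : Path.Homotopic.Quotient (f s'₀) t) (hγ : D.IsHodgeAt t p (D.VZ.transport γ u₀)) :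
    ∃ t' : S', f t' = t ∧ ∃ γ' : Path.Homotopic.Quotient s'₀ t', (D.comap f).IsHodgeAt t' p ((D.comap f).VZ.transport γ' u₀) := by
  -- for every point `m` of the fibre over `t` and every path class `γ'` to it lying over `γ`, `γ' · u₀` is of type `(p,p)` for `f* D`
  have key : ∀ (m : f ⁻¹' {t}) (γ' : Path.Homotopic.Quotient s'₀ m.1), γ'.map f = γ.cast rfl m.2 →
      (D.comap f).IsHodgeAt m.1 p ((D.comap f).VZ.transport γ' u₀) := by
    rintro ⟨t', ht'⟩ γ' hγ'
    change f t' = t at ht'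
    subst ht'
    rw [isHodgeAt_comap_iff, comap_VZ_transport, hγ', Path.Homotopic.Quotient.cast_rfl_rfl]
    exact hγ
  exact ⟨_, (hf.monodromy γ ⟨s'₀, rfl⟩).2, hf.liftPathQuotient γ ⟨s'₀, rfl⟩,
    key _ (hf.liftPathQuotient γ ⟨s'₀, rfl⟩) (hf.map_liftPathQuotient γ ⟨s'₀, rfl⟩)⟩

/-- **«Some determination of `u` is of type `(p,p)`» seen from a covering space**: for a covering map `f : S' → S`, `s'₀ ∈ S'` and an integral
`u₀ ∈ V_ℤ,f(s'₀)`, **`f (determination locus of u₀ for f* D from s'₀) = determination locus of u₀ for D from f s'₀`**: `⊆` because transport upstairs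
is transport along the image path (`determinationLocus_comap_subset`), `⊇` by path lifting. [cite: CattaniDeligneKaplan1995, Cor. 1.3 (p. 484)] [cite: Deligne1970, I.1] -/
theorem image_determinationLocus_comap (hf : IsCoveringMap f) (p : ℤ) (s'₀ : S') (u₀ : D.VZ.fiber (f s'₀)) :
    f '' {t' : S' | ∃ γ' : Path.Homotopic.Quotient s'₀ t', (D.comap f).IsHodgeAt t' p ((D.comap f).VZ.transport γ' u₀)} =
      {t : S | ∃ γ : Path.Homotopic.Quotient (f s'₀) t, D.IsHodgeAt t p (D.VZ.transport γ u₀)} := by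
  refine Subset.antisymm (image_subset_iff.2 (D.determinationLocus_comap_subset f p s'₀ u₀)) ?_
  rintro t ⟨γ, hγ⟩
  obtain ⟨t', ht', h⟩ := D.exists_isHodgeAt_comap_of_isHodgeAt hf u₀ γ hγ
  exact ⟨t', h, ht'⟩

/-- Membership form: `t` carries a determination of `u₀` of type `(p,p)` iff SOME point `t'` of the fibre `f⁻¹(t)` carries one for `f* D` (from `s'₀`).
[cite: CattaniDeligneKaplan1995, Cor. 1.3 (p. 484)] -/
theorem mem_determinationLocus_iff_exists_fiber (hf : IsCoveringMap f) (p : ℤ) (s'₀ : S') (u₀ : D.VZ.fiber (f s'₀)) (t : S) :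
    (∃ γ : Path.Homotopic.Quotient (f s'₀) t, D.IsHodgeAt t p (D.VZ.transport γ u₀)) ↔
      ∃ t' : S', f t' = t ∧ ∃ γ' : Path.Homotopic.Quotient s'₀ t', (D.comap f).IsHodgeAt t' p ((D.comap f).VZ.transport γ' u₀) := by
  constructor
  · rintro ⟨γ, hγ⟩
    exact D.exists_isHodgeAt_comap_of_isHodgeAt hf u₀ γ hγ
  · rintro ⟨t', rfl, γ', h⟩
    exact D.determinationLocus_comap_subset f p s'₀ u₀ ⟨γ', h⟩

/-! ## §2 Descent of «everything or finite» for the determination locus along a surjective covering map -/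

/-- **DESCENT** («one is free to replace `S` by a finite etale covering `S' → S`», for Cor. 1.3 over a curve): for a SURJECTIVE covering map `f`,
if the determination locus of `u₀` for `f* D` from `s'₀` is all of `S'` or finite, then the determination locus of `u₀` for `D` from `f s'₀` is
all of `S` or finite (it is its image under `f`). [cite: CattaniDeligneKaplan1995, Cor. 1.3 (p. 484) and «Proof of 1.5 ⟹ 1.1» (p. 485)] -/
theorem determinationLocus_eq_univ_or_finite_of_comap_covering (hf : IsCoveringMap f) (hsurj : Function.Surjective f) {p : ℤ} {s'₀ : S'}
    (u₀ : D.VZ.fiber (f s'₀))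
    (h : {t' : S' | ∃ γ' : Path.Homotopic.Quotient s'₀ t', (D.comap f).IsHodgeAt t' p ((D.comap f).VZ.transport γ' u₀)} = univ ∨
      {t' : S' | ∃ γ' : Path.Homotopic.Quotient s'₀ t', (D.comap f).IsHodgeAt t' p ((D.comap f).VZ.transport γ' u₀)}.Finite) :
    {t : S | ∃ γ : Path.Homotopic.Quotient (f s'₀) t, D.IsHodgeAt t p (D.VZ.transport γ u₀)} = univ ∨
      {t : S | ∃ γ : Path.Homotopic.Quotient (f s'₀) t, D.IsHodgeAt t p (D.VZ.transport γ u₀)}.Finite := by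
  rw [← D.image_determinationLocus_comap hf p s'₀ u₀]
  rcases h with huniv | hfin
  · exact Or.inl (by rw [huniv, image_univ, hsurj.range_eq])
  · exact Or.inr (hfin.image f)

/-- The finite half needs no surjectivity: a FINITE determination locus upstairs gives a finite one downstairs.
[cite: CattaniDeligneKaplan1995, Cor. 1.3 (p. 484)] -/
theorem determinationLocus_finite_of_comap_covering (hf : IsCoveringMap f) {p : ℤ} {s'₀ : S'} (u₀ : D.VZ.fiber (f s'₀))
    (h : {t' : S' | ∃ γ' : Path.Homotopic.Quotient s'₀ t', (D.comap f).IsHodgeAt t' p ((D.comap f).VZ.transport γ' u₀)}.Finite) :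
    {t : S | ∃ γ : Path.Homotopic.Quotient (f s'₀) t, D.IsHodgeAt t p (D.VZ.transport γ u₀)}.Finite := by
  rw [← D.image_determinationLocus_comap hf p s'₀ u₀]
  exact h.image f

/-- And «everything upstairs» gives «everything downstairs» for `f` surjective. [cite: CattaniDeligneKaplan1995, Cor. 1.3 (p. 484)] -/
theorem determinationLocus_eq_univ_of_comap_covering (hf : IsCoveringMap f) (hsurj : Function.Surjective f) {p : ℤ} {s'₀ : S'}
    (u₀ : D.VZ.fiber (f s'₀))
    (h : {t' : S' | ∃ γ' : Path.Homotopic.Quotient s'₀ t', (D.comap f).IsHodgeAt t' p ((D.comap f).VZ.transport γ' u₀)} = univ) :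
    {t : S | ∃ γ : Path.Homotopic.Quotient (f s'₀) t, D.IsHodgeAt t p (D.VZ.transport γ u₀)} = univ := by
  rw [← D.image_determinationLocus_comap hf p s'₀ u₀, h, image_univ, hsurj.range_eq]

/-! ## §3 On a simply connected cover «some determination» is the flat section -/

/-- **On a SIMPLY CONNECTED base the determination is unique**: «∃ γ' : s'₀ ⇝ t', γ' · u₀ of type `(p,p)`» is equivalent to «γ'₀ · u₀ of type `(p,p)`»
for ANY fixed path class `γ'₀` — the flat continuation of `u₀` is a well-defined section `u` of `f* V_ℤ` («a section of the local system `𝒱_ℤ` on a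
universal covering of `S`»). [cite: CattaniDeligneKaplan1995, Cor. 1.3 (p. 484)] [cite: Deligne1970, I.1] -/
theorem exists_isHodgeAt_transport_iff_of_simplyConnected [SimplyConnectedSpace S'] (E : VHSData S' n) {p : ℤ} {s'₀ t' : S'}
    (u₀ : E.VZ.fiber s'₀) (γ'₀ : Path.Homotopic.Quotient s'₀ t') :
    (∃ γ' : Path.Homotopic.Quotient s'₀ t', E.IsHodgeAt t' p (E.VZ.transport γ' u₀)) ↔ E.IsHodgeAt t' p (E.VZ.transport γ'₀ u₀) := by
  exact ⟨fun ⟨γ', h⟩ => Subsingleton.elim γ' γ'₀ ▸ h, fun h => ⟨γ'₀, h⟩⟩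

/-- **The determination locus of `f* D` on a simply connected `S'`** is the set of `t'` where the flat continuation of `u₀` (along ANY path class,
e.g. the one furnished by path-connectedness) is of type `(p,p)`: `{t' | ∃ γ', …} = {t' | ∀ γ', …}`.
[cite: CattaniDeligneKaplan1995, Cor. 1.3 (p. 484)] [cite: Deligne1970, I.1] -/
theorem determinationLocus_comap_eq_of_simplyConnected [SimplyConnectedSpace S'] (p : ℤ) (s'₀ : S') (u₀ : D.VZ.fiber (f s'₀)) :
    {t' : S' | ∃ γ' : Path.Homotopic.Quotient s'₀ t', (D.comap f).IsHodgeAt t' p ((D.comap f).VZ.transport γ' u₀)} =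
      {t' : S' | ∀ γ' : Path.Homotopic.Quotient s'₀ t', (D.comap f).IsHodgeAt t' p ((D.comap f).VZ.transport γ' u₀)} := by
  ext t'
  obtain ⟨γ'₀⟩ : Nonempty (Path.Homotopic.Quotient s'₀ t') :=
    ⟨⟦(PathConnectedSpace.joined s'₀ t').somePath⟧⟩
  simp only [mem_setOf_eq]
  exact ⟨fun ⟨γ', h⟩ δ => Subsingleton.elim γ' δ ▸ h, fun h => ⟨γ'₀, h γ'₀⟩⟩

/-- **Cor. 1.3 as printed**: for a SURJECTIVE covering map `f : S' → S` from a SIMPLY CONNECTED `S'` («a universal covering of `S`»), a base point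
`s'₀` and `u₀ ∈ V_ℤ,f(s'₀)` — so that `u₀` continues to a unique flat section `u` of `f* V_ℤ` —, **the set of points of `S` where some determination of
`u` is of type `(p,p)` is the IMAGE under `f` of `{t' ∈ S' | u(t') is of type (p,p)}`** (with `u(t') = γ' · u₀` for every `γ' : s'₀ ⇝ t'`).
[cite: CattaniDeligneKaplan1995, Cor. 1.3 (p. 484)] [cite: Deligne1970, I.1] -/
theorem determinationLocus_eq_image_of_simplyConnected [SimplyConnectedSpace S'] (hf : IsCoveringMap f) (p : ℤ) (s'₀ : S')
    (u₀ : D.VZ.fiber (f s'₀)) :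
    {t : S | ∃ γ : Path.Homotopic.Quotient (f s'₀) t, D.IsHodgeAt t p (D.VZ.transport γ u₀)} =
      f '' {t' : S' | ∀ γ' : Path.Homotopic.Quotient s'₀ t', (D.comap f).IsHodgeAt t' p ((D.comap f).VZ.transport γ' u₀)} := by
  rw [← D.determinationLocus_comap_eq_of_simplyConnected p s'₀ u₀, D.image_determinationLocus_comap hf p s'₀ u₀]

end VHSData

end Literature.AlgebraicGeometry.Motives

end
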